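import Summits.CriticalPhenomena.CardyFormulaZ2.Theorems.CardyTensorRGPolyominoGaussianLawDyadicCores
import Summits.CriticalPhenomena.CardyFormulaZ2.Theorems.CardyTensorRGPolyominoGaussianLawOfCardy
import Summits.CriticalPhenomena.CardyFormulaZ2.Theorems.CardyTensorRGPolyominoToJordan

/-!
# Under Cardy rigidity the crux `PolyominoGaussianLaw` is the SHAPE-FREE universal polyomino law
# (stmt-CriticalPhenomena-14337, route `CardyTensorRG`, line `registered`)

The crux `CardyTensorRG.PolyominoGaussianLaw` asks for ONE exponent `a ∈ (0,1)` and the specific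
normalised incomplete beta law `I_a(η)` as the bond-`ℤ²` crossing limit of every polyomino conformal
rectangle with lattice marks. This file shows that, granted the route's own third hypothesis
`CardyRigidity` (stmt-CriticalPhenomena-0746: a cross-ratio law valid for ALL conformal rectangles is
Cardy's function on `(0,1)`), the beta-law / one-exponent SHAPE of the limit is not load-bearing:

* `stub_universalLawIff` — `CardyRigidity → (PolyominoGaussianLaw ↔ ∃ F, ContinuousOn F (0,1) ∧ every
  polyomino conformal rectangle with lattice marks has crossing limit F(cross-ratio))`;
* `stub_dyadicUniversalLawIff` — the same with the universal law required only ALONG THE DYADIC ORBITS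
  `δ₀ · 2^(−k)` of every polyomino representation (what the tensor RG iterates).

`→`: `F = I_a` is continuous on `(0,1)` (`continuousOn_betaLaw`: `(s(1-s))^{-a}` is interval-integrable
on `[0,1]` for `a < 1`). `←`: a continuous universal polyomino law `F` extends to every conformal
rectangle by the PROVED crux `PolyominoToJordan` (`PolyominoToJordan_proof`, stmt-14338), rigidity makes
it Cardy's function on `(0,1)`, and Cardy's function is `I_{2/3}` there (`stub_ofCardyLatticePolygon`);
in the dyadic version the orbit law is first upgraded to the one-sided limit `δ → 0⁺` by refinement of
representations, mesh equicontinuity and the log-scale net lemma of the line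
(`hasCrossingLimit_of_dyadicLaw`, the `F`-generic form of the landed reduction `stub_reductionToDyadic`).

Consequence for the route: since `closes : PolyominoGaussianLaw → PolyominoToJordan → CardyRigidity →
CardyFormulaZ2` already carries `CardyRigidity`, what GaussianSaddleCertificate + BoundaryTwistTensors +
RGToPolyominoLaw (stmt-13817, 7100, 14645) must deliver for this crux is only: dyadic polyomino crossing
limits EXIST and depend CONTINUOUSLY on the conformal cross-ratio ALONE — no identification of the
Gaussian / Coulomb-gas law and no exponent bookkeeping.
-/

open Filter Topology Set

namespace Summit.CriticalPhenomena.CardyFormulaZ2.Cruxes.PolyominoGaussianLaw.Birth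

/-- The normalised incomplete beta law `I_a(η) = ∫₀^η (s(1-s))^{-a} ds / ∫₀¹ (s(1-s))^{-a} ds` is
continuous on `(0,1)` for `a < 1` (the kernel is interval-integrable on `[0,1]`). [folklore] -/
theorem continuousOn_betaLaw {a : ℝ} (ha : a < 1) :
    ContinuousOn (fun η : ℝ => intervalIntegral (fun s : ℝ => (s * (1 - s)) ^ (-a)) 0 η MeasureTheory.volume /
      intervalIntegral (fun s : ℝ => (s * (1 - s)) ^ (-a)) 0 1 MeasureTheory.volume) (Set.Ioo 0 1) := by
  -- the kernel is interval-integrable on [0, 1/2] (rpow singularity of exponent -a > -1) …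
  have hhalf : IntervalIntegrable (fun s : ℝ => (s * (1 - s)) ^ (-a)) MeasureTheory.volume 0 (1 / 2) := by
    have h1 : IntervalIntegrable (fun s : ℝ => s ^ (-a)) MeasureTheory.volume 0 (1 / 2) :=
      intervalIntegral.intervalIntegrable_rpow' (by linarith)
    have h2 : ContinuousOn (fun s : ℝ => (1 - s) ^ (-a)) (Set.uIcc 0 (1 / 2)) := by
      refine ContinuousOn.rpow_const (continuousOn_const.sub continuousOn_id) fun s hs => Or.inl ?_
      rw [Set.uIcc_of_le (by norm_num : (0 : ℝ) ≤ 1 / 2)] at hs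
      have := hs.2
      intro h
      linarith
    refine (h1.mul_continuousOn h2).congr_uIoo fun s hs => ?_
    rw [Set.uIoo_of_le (by norm_num : (0 : ℝ) ≤ 1 / 2)] at hs
    simp only
    rw [Real.mul_rpow hs.1.le (by linarith [hs.2])]
  -- … and on [1/2, 1] by the symmetry s ↦ 1 - s, hence on [0, 1]
  have hker : IntervalIntegrable (fun s : ℝ => (s * (1 - s)) ^ (-a)) MeasureTheory.volume 0 1 := by
    refine hhalf.trans ?_
    have h := hhalf.comp_sub_left 1
    have hsym : (fun s : ℝ => ((1 - s) * (1 - (1 - s))) ^ (-a)) = fun s : ℝ => (s * (1 - s)) ^ (-a) := by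
      funext s
      rw [sub_sub_cancel, mul_comm]
    rw [hsym] at h
    norm_num at h
    exact h.symm
  have h := (intervalIntegral.continuousOn_primitive_interval' hker Set.left_mem_uIcc).div_const
    (intervalIntegral (fun s : ℝ => (s * (1 - s)) ^ (-a)) 0 1 MeasureTheory.volume)
  rw [Set.uIcc_of_le zero_le_one] at h
  exact h.mono Set.Ioo_subset_Icc_self

/-- **From a dyadic orbit law to the one-sided limit, for a GENERAL law `F`** (the `F`-generic form of
the landed reduction `stub_reductionToDyadic`): if along the dyadic orbit `δ₀ · 2^(−k)` of EVERY polyomino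
representation with lattice marks the crossing probabilities converge to `F(crossRatio x)` for every
uniformizing datum, then every polyomino conformal rectangle has crossing limit `F` as `δ → 0⁺`
(refinement `stub_polyominoRefinement` gives all blocking orbits `δ₀/(q·2^k)`, mesh equicontinuity
`stub_meshEquicontinuity` and the net lemma `tendsto_nhdsWithin_zero_of_orbits` do the rest). [folklore] -/
theorem hasCrossingLimit_of_dyadicLaw {F : ℝ → ℝ}
    (hD : ∀ R : Literature.Probability.RandomPlanarGeometry.ConformalRectangle, ∀ δ₀ : ℝ, 0 < δ₀ →
      (∃ s : Finset (ℤ × ℤ), R.carrier = interior (⋃ p ∈ s, {z : ℂ | δ₀ * (p.1 : ℝ) ≤ z.re ∧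
        z.re ≤ δ₀ * ((p.1 : ℝ) + 1) ∧ δ₀ * (p.2 : ℝ) ≤ z.im ∧ z.im ≤ δ₀ * ((p.2 : ℝ) + 1)})) →
      (∀ i, ∃ m n : ℤ, R.pt i = (δ₀ : ℂ) * ((m : ℂ) + (n : ℂ) * Complex.I)) →
      ∀ (φ : Literature.Probability.RandomPlanarGeometry.ConformalEquiv UpperHalfPlane.upperHalfPlaneSet R.carrier)
        (x : Fin 4 → ℝ), R.IsUniformizing φ x →
      Filter.Tendsto
        (fun k : ℕ => Literature.Probability.Percolation.bondDomainCrossingProb R (δ₀ / 2 ^ k))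
        Filter.atTop (nhds (F (Literature.Probability.RandomPlanarGeometry.crossRatio x)))) :
    ∀ R : Literature.Probability.RandomPlanarGeometry.ConformalRectangle,
      (∃ δ₀ : ℝ, 0 < δ₀ ∧ (∃ s : Finset (ℤ × ℤ), R.carrier = interior (⋃ p ∈ s, {z : ℂ |
        δ₀ * (p.1 : ℝ) ≤ z.re ∧ z.re ≤ δ₀ * ((p.1 : ℝ) + 1) ∧ δ₀ * (p.2 : ℝ) ≤ z.im ∧
        z.im ≤ δ₀ * ((p.2 : ℝ) + 1)})) ∧ ∀ i, ∃ m n : ℤ, R.pt i = (δ₀ : ℂ) * ((m : ℂ) + (n : ℂ) * Complex.I)) →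
      R.HasCrossingLimit (Literature.Probability.Percolation.bondDomainCrossingProb R) F := by
  intro R hR φ x hφ
  obtain ⟨δ₀, hδ₀, hs, hmarks⟩ := hR
  have horbit : ∀ q : ℕ, 1 ≤ q → Tendsto
      (fun k : ℕ => Literature.Probability.Percolation.bondDomainCrossingProb R (δ₀ / ((q : ℝ) * 2 ^ k)))
      atTop (𝓝 (F (Literature.Probability.RandomPlanarGeometry.crossRatio x))) := by
    intro q hq
    have hq0 : (0 : ℝ) < q := by exact_mod_cast hq
    obtain ⟨hs', hmarks'⟩ := stub_polyominoRefinement R δ₀ hδ₀ hs hmarks q hq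
    have hL := hD R (δ₀ / (q : ℝ)) (div_pos hδ₀ hq0) hs' hmarks' φ x hφ
    have heq : (fun k : ℕ => Literature.Probability.Percolation.bondDomainCrossingProb R (δ₀ / ((q : ℝ) * 2 ^ k))) =
        fun k : ℕ => Literature.Probability.Percolation.bondDomainCrossingProb R (δ₀ / (q : ℝ) / 2 ^ k) := by
      funext k
      rw [div_div]
    rw [heq]
    exact hL
  exact tendsto_nhdsWithin_zero_of_orbits hδ₀ horbit (stub_meshEquicontinuity R ⟨δ₀, hδ₀, hs, hmarks⟩)

/-- **A continuous universal polyomino law forces the crux (with `a = 2/3`), granted Cardy rigidity**: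
the law extends to all conformal rectangles by the proved crux `PolyominoToJordan`, rigidity makes it
Cardy's function on `(0,1)`, and Cardy's function is `I_{2/3}` there. [folklore] -/
theorem polyominoGaussianLaw_of_universalLaw
    (hRig : Summit.CriticalPhenomena.CardyFormulaZ2.Theses.CardyTensorRG.CardyRigidity)
    {F : ℝ → ℝ} (hF : ContinuousOn F (Set.Ioo 0 1))
    (hpoly : ∀ R : Literature.Probability.RandomPlanarGeometry.ConformalRectangle,
      (∃ δ₀ : ℝ, 0 < δ₀ ∧ (∃ s : Finset (ℤ × ℤ), R.carrier = interior (⋃ p ∈ s, {z : ℂ |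
        δ₀ * (p.1 : ℝ) ≤ z.re ∧ z.re ≤ δ₀ * ((p.1 : ℝ) + 1) ∧ δ₀ * (p.2 : ℝ) ≤ z.im ∧
        z.im ≤ δ₀ * ((p.2 : ℝ) + 1)})) ∧ ∀ i, ∃ m n : ℤ, R.pt i = (δ₀ : ℂ) * ((m : ℂ) + (n : ℂ) * Complex.I)) →
      R.HasCrossingLimit (Literature.Probability.Percolation.bondDomainCrossingProb R) F) :
    Summit.CriticalPhenomena.CardyFormulaZ2.Theses.CardyTensorRG.PolyominoGaussianLaw := by
  -- Jordan extension to every conformal rectangle, then rigidity: F = cardyFunction on (0,1)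
  have hall := Summit.CriticalPhenomena.CardyFormulaZ2.Cruxes.PolyominoToJordan.Birth.PolyominoToJordan_proof
    F hF hpoly
  have hEq := hRig F hall
  refine stub_ofCardyLatticePolygon fun R hR φ x hφ => ?_
  have hη : Literature.Probability.RandomPlanarGeometry.crossRatio x ∈ Set.Ioo (0 : ℝ) 1 :=
    Literature.Probability.RandomPlanarGeometry.ConformalRectangle.crossRatio_mem_Ioo_of_isUniformizing hφ
  rw [← hEq hη]
  exact hpoly R hR φ x hφ

/-- **Under Cardy rigidity the crux is the shape-free universal polyomino law** (registered helper
stub): `PolyominoGaussianLaw ↔ ∃ F` continuous on `(0,1)` such that every polyomino conformal rectangle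
with lattice marks has bond-`ℤ²` crossing limit `F(cross-ratio)`. [folklore] -/
theorem stub_universalLawIff :
    Summit.CriticalPhenomena.CardyFormulaZ2.Theses.CardyTensorRG.CardyRigidity →
    (Summit.CriticalPhenomena.CardyFormulaZ2.Theses.CardyTensorRG.PolyominoGaussianLaw ↔
      ∃ F : ℝ → ℝ, ContinuousOn F (Set.Ioo 0 1) ∧
        ∀ R : Literature.Probability.RandomPlanarGeometry.ConformalRectangle,
        (∃ δ₀ : ℝ, 0 < δ₀ ∧ (∃ s : Finset (ℤ × ℤ), R.carrier = interior (⋃ p ∈ s, {z : ℂ |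
          δ₀ * (p.1 : ℝ) ≤ z.re ∧ z.re ≤ δ₀ * ((p.1 : ℝ) + 1) ∧ δ₀ * (p.2 : ℝ) ≤ z.im ∧
          z.im ≤ δ₀ * ((p.2 : ℝ) + 1)})) ∧ ∀ i, ∃ m n : ℤ, R.pt i = (δ₀ : ℂ) * ((m : ℂ) + (n : ℂ) * Complex.I)) →
        R.HasCrossingLimit (Literature.Probability.Percolation.bondDomainCrossingProb R) F) := by
  intro hRig
  constructor
  · rintro ⟨a, ha, hpoly⟩
    exact ⟨_, continuousOn_betaLaw ha.2, hpoly⟩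
  · rintro ⟨F, hF, hpoly⟩
    exact polyominoGaussianLaw_of_universalLaw hRig hF hpoly

/-- **Under Cardy rigidity the crux is the shape-free universal law ALONG DYADIC ORBITS** (registered
helper stub): `PolyominoGaussianLaw ↔ ∃ F` continuous on `(0,1)` such that along the dyadic orbit
`δ₀ · 2^(−k)` of every polyomino representation with lattice marks the bond-`ℤ²` crossing probabilities
converge to `F(crossRatio x)` for every uniformizing datum. This is the exact deliverable of the
tensor-RG chain (stmt-13817 + 7100 + 14645) for this crux once `CardyRigidity` (stmt-0746) is in hand:
existence of the dyadic limits and their continuous dependence on the cross-ratio alone. [folklore] -/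
theorem stub_dyadicUniversalLawIff :
    Summit.CriticalPhenomena.CardyFormulaZ2.Theses.CardyTensorRG.CardyRigidity →
    (Summit.CriticalPhenomena.CardyFormulaZ2.Theses.CardyTensorRG.PolyominoGaussianLaw ↔
      ∃ F : ℝ → ℝ, ContinuousOn F (Set.Ioo 0 1) ∧
        ∀ R : Literature.Probability.RandomPlanarGeometry.ConformalRectangle, ∀ δ₀ : ℝ, 0 < δ₀ →
        (∃ s : Finset (ℤ × ℤ), R.carrier = interior (⋃ p ∈ s, {z : ℂ | δ₀ * (p.1 : ℝ) ≤ z.re ∧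
          z.re ≤ δ₀ * ((p.1 : ℝ) + 1) ∧ δ₀ * (p.2 : ℝ) ≤ z.im ∧ z.im ≤ δ₀ * ((p.2 : ℝ) + 1)})) →
        (∀ i, ∃ m n : ℤ, R.pt i = (δ₀ : ℂ) * ((m : ℂ) + (n : ℂ) * Complex.I)) →
        ∀ (φ : Literature.Probability.RandomPlanarGeometry.ConformalEquiv UpperHalfPlane.upperHalfPlaneSet R.carrier)
          (x : Fin 4 → ℝ), R.IsUniformizing φ x →
        Filter.Tendsto
          (fun k : ℕ => Literature.Probability.Percolation.bondDomainCrossingProb R (δ₀ / 2 ^ k))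
          Filter.atTop (nhds (F (Literature.Probability.RandomPlanarGeometry.crossRatio x)))) := by
  intro hRig
  constructor
  · rintro ⟨a, ha, hpoly⟩
    refine ⟨_, continuousOn_betaLaw ha.2, ?_⟩
    intro R δ₀ hδ₀ hs hmarks φ x hφ
    exact (hpoly R ⟨δ₀, hδ₀, hs, hmarks⟩ φ x hφ).comp (tendsto_dyadicMesh hδ₀)
  · rintro ⟨F, hF, hD⟩
    exact polyominoGaussianLaw_of_universalLaw hRig hF (hasCrossingLimit_of_dyadicLaw hD)

end Summit.CriticalPhenomena.CardyFormulaZ2.Cruxes.PolyominoGaussianLaw.Birth
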